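import Summits.QuantumFields.BalabanUV.T4Continuum.Support.NE3FlatWeightedCoercive
import Summits.QuantumFields.BalabanUV.T4Continuum.Support.NE3BlockPoincareTangent
import HarnessLib

/-!
# T⁴ programme, node NE3 — (ML_w) AT THE FLAT BACKGROUND, HYPOTHESIS-FREE: `WeightedTangentCoercive L k 1 (flatTangentLandau L N k)
# (1/(n·(6 + 2d·N²))) [0, N·L^k)^d`, and the η-weighted Poincaré–Hodge inequality (P_W) at `W = 1` — (w1) ∘ (w2) ∘ (w3) discharged

NE3 formalisation swarm, LEAF PROVER 02 (unit `b2b-balaban-t4-ne3-formalise-leaf-02`, gen 4; cell `pub-balaban`); sub-row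
E-MLw-asm of `t4/formal/NE3/LEAVES.md` (typer v1.46 (ρ124)), owner skeleton `SKELETON-NE3-P1.md` v1.10 §4b: «(w1) + (w2) + (w3)
⇒ c_w(flat) = 1/(n(1 + C_P)) = (ML_w) AT THE FLAT BACKGROUND».  The three leaves are in the tree: (w1) `NE3FlatHessianCurl` p218926
(leaf-03-g5), (w2) `NE3LatticeWeitzenbock` p219171 (this seat), (w3) `NE3BlockPoincareTangent.sum_nhsNormSq_le_of_tangentIter_flat`
p219822 (leaf-04-g4; `C_P = 5 + 2·d·N²`, k-free, N = torus size in `L^k`-blocks).  The assembly modulo (w3) is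
`NE3FlatWeightedCoercive.weightedTangentCoercive_flatTangentLandau_of_blockPoincare` p219617 (this seat), whose hypothesis `hP` IS
(w3)'s END literally.  THIS FILE is the one-line discharge.

CONTENT ([folklore]; 0 `def`, 0 sorry; `n := Fintype.card n ≥ 1`; `L, N, k ≥ 1`):
* **`weightedTangentCoercive_flatTangentLandau`** — `WeightedTangentCoercive L k flatCfg (flatTangentLandau L N k)
  (1/(card n·(1 + (5 + 2·d·N²)))) (periodBox (N·L^k))`: the socket (ML_w) `NE3EnergyWeightedShapes.WeightedTangentCoercive`
  INHABITED at `W = 1` on the constrained Landau tangent space `NE3CoercivityScaling.flatTangentLandau` with the k-FREE constant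
  `c_w(flat) = 1/(n(6 + 2dN²))` — NO hypothesis beyond `1 ≤ L`, `1 ≤ N`, `1 ≤ k`;
* **`weightedPoincare_flatTangentLandau`** — (P_W) AT `W = 1` in the (P_U) currency of `NE3WeightedCoercivityTransfer` (leaf-03-g6):
  `∀ Y ∈ flatTangentLandau L N k, (L^k)⁻²·dirSq Y F ≤ (card n·(5 + 2·d·N²))·curlSq flatCfg Y F`, `F = [0, N·L^k)^d`.
CONTRAST (tree, same tangent space): in the UNWEIGHTED currency no k-uniform constant exists —
`NE3CoercivityScaling.not_tangentCoercive_uniform` (c ≤ 12/(L^k + 1)); in the WEIGHTED currency the constant above is k-free.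
The `N²` is the torus factor of the single-bar tangent space (leaf-04-g4 SHAPE §1; owner ruling «N² accepted (fixed torus)»).

HONEST FRAMING.  A theorem about OUR typed shapes at ONE (flat) configuration — the flat core of the repaired leaf (ML_w); (ML_w) at
the moving∕small background `W = cavg L U_B` ((w4): (P_W) there) is NOT proved; T-E_w, NE3 NOT proved; nothing about Bałaban's
minimisers; spine PROVED 0/9; finite T⁴ rung (B)+1 — NOT infinite volume, NOT mass gap, NOT `BetaPertH`, NOT Clay.  HONEST
DEPENDENCY: continuum YM on T⁴ ⇐ BetaPertH ∧ nine spine estimates (0/9 proved); BetaPertH ⇐ (D1) ∧ (D4) ∧ CAP+tail; G-an2-4 gates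
asym, D1 and NE2/3/4.  ABSOLUTE RULE kept: no printed sentence is a hypothesis (context only: [Balaban1985PropagatorsII] Thm 3.3
(3.46), [Balaban1984PropagatorsII] (2.153) — η-weighted coercivity statements); no `def … : Prop`.  PLACEMENT: our work,
`Summits/QuantumFields/BalabanUV/`; imports accepted modules only.
-/

set_option autoImplicit false

open scoped BigOperators Matrix Matrix.Norms.L2Operator
open Finset

namespace Summit.QuantumFields.BalabanUV.T4Continuum.NE3FlatWeightedCoerciveEnd

open Literature.MathematicalPhysics.QuantumFieldTheory.Balaban1983to89
open B7Prop1Explicit (Site e)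
open T4AveragingDeficitWall (curlSq dirSq)
open T4AveragingDeficitWallBoundary (periodBox)
open MinimalActionWitness (flatCfg)
open NE3EnergyWeightedShapes (WeightedTangentCoercive)
open NE3CoercivityScaling (flatTangentLandau)
open NE3FlatWeightedCoercive (weightedTangentCoercive_flatTangentLandau_of_blockPoincare
  weightedPoincare_flatTangentLandau_of_blockPoincare)
open NE3BlockPoincareTangent (sum_nhsNormSq_le_of_tangentIter_flat)

noncomputable section

variable {d : ℕ} {n : Type*} [Fintype n] [DecidableEq n] [Nonempty n]

/-- **(ML_w) AT THE FLAT BACKGROUND ON THE CONSTRAINED LANDAU TANGENT SPACE, HYPOTHESIS-FREE** (`L, N, k ≥ 1`):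
`WeightedTangentCoercive L k flatCfg (flatTangentLandau L N k) (1/(card n·(1 + (5 + 2·d·N²)))) (periodBox (N·L^k))` — the
socket of the owner's leaf (ML_w) inhabited at `W = 1` with the k-FREE constant `1/(n(6 + 2dN²))`: (w1) flat Hessian = HS curl
energy ∘ (w2) lattice Weitzenböck (Landau) ∘ (w3) block-Poincaré on `ker d(avgIter k)(1)` (`C_P = 5 + 2dN²`). [folklore] -/
theorem weightedTangentCoercive_flatTangentLandau {L N k : ℕ} (hL : 1 ≤ L) (hN : 1 ≤ N) (hk : 1 ≤ k) :
    WeightedTangentCoercive L k (flatCfg (d := d) (n := n)) (flatTangentLandau L N k)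
      (1 / (Fintype.card n * (1 + (5 + 2 * d * (N : ℝ) ^ 2)))) (periodBox (N * L ^ k)) :=
  weightedTangentCoercive_flatTangentLandau_of_blockPoincare hL hN hk (by positivity)
    fun _ _ hper htan => sum_nhsNormSq_le_of_tangentIter_flat hL hN hper htan

/-- The same with the constant displayed as `1/(card n·(6 + 2·d·N²))`. [folklore] -/
theorem weightedTangentCoercive_flatTangentLandau' {L N k : ℕ} (hL : 1 ≤ L) (hN : 1 ≤ N) (hk : 1 ≤ k) :
    WeightedTangentCoercive L k (flatCfg (d := d) (n := n)) (flatTangentLandau L N k)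
      (1 / (Fintype.card n * (6 + 2 * d * (N : ℝ) ^ 2))) (periodBox (N * L ^ k)) := by
  have h := weightedTangentCoercive_flatTangentLandau (d := d) (n := n) hL hN hk
  rwa [show (1 : ℝ) + (5 + 2 * d * (N : ℝ) ^ 2) = 6 + 2 * d * (N : ℝ) ^ 2 by ring] at h

/-- **(P_W) AT `W = 1` ON THE CONSTRAINED LANDAU TANGENT SPACE, HYPOTHESIS-FREE** (`L, N, k ≥ 1`), in the (P_U) currency of
`NE3WeightedCoercivityTransfer.weightedTangentCoercive_of_weightedPoincare(_periodBox)`: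
`∀ Y ∈ flatTangentLandau L N k, (L^k)⁻²·dirSq Y [0,N·L^k)^d ≤ (card n·(5 + 2·d·N²))·curlSq flatCfg Y [0,N·L^k)^d`. [folklore] -/
theorem weightedPoincare_flatTangentLandau {L N k : ℕ} (hL : 1 ≤ L) (hN : 1 ≤ N) (hk : 1 ≤ k) :
    ∀ Y ∈ flatTangentLandau (d := d) (n := n) L N k, (((L : ℝ) ^ k)⁻¹) ^ 2 * dirSq Y (periodBox (N * L ^ k))
      ≤ (Fintype.card n * (5 + 2 * d * (N : ℝ) ^ 2)) * curlSq (flatCfg (d := d) (n := n)) Y (periodBox (N * L ^ k)) :=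
  weightedPoincare_flatTangentLandau_of_blockPoincare hL hN hk (by positivity)
    fun _ _ hper htan => sum_nhsNormSq_le_of_tangentIter_flat hL hN hper htan

end

end Summit.QuantumFields.BalabanUV.T4Continuum.NE3FlatWeightedCoerciveEnd
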